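import Literature.Barriers.AtomisticToContinuum.AnticontinuumLocalizationCancellation
import Literature.Barriers.AtomisticToContinuum.AnticontinuumLocalizationLocality
import Literature.MathematicalPhysics.KineticTheory.TrigPolySupBounds
import HarnessLib

/-!
# De Roeck–Huveneers 2015, §5.6 for the rotor chain, I: symbolic representatives and the bounds on `U`

`Literature/Barriers/AtomisticToContinuum/` — the pointwise bounds behind Theorem 1 for `U = U₀`
(§5.2, §5.6) of W. De Roeck, F. Huveneers, CPAM 68 (2015), arXiv:1305.5127, all PROVED:

* symbolic representatives of `R H̃_{>a}` (`RhgtSym`), of `H̃ · H̃_{>a}` (`Xsym`), of `R(H̃ · H̃_{>a})`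
  (`RXsym`) and of `B = {V, (R H̃_{>a})_n}` (`Bsym`), with their evaluation identities, and their
  `δ`-classes (`(R H̃_{>a})_j ∼ δ^{-2j}`; `X_l, (RX)_l ∼ δ^{-(2l+1)}`; `B ∼ δ^{-(2n+1)}`, as in §5.6);
* the decomposition `U₀ = U₀⁽⁰⁾ + ε(V_{>a} - (RH̃_{>a})_1) - ∑_{j≥2} ε^j (RH̃_{>a})_j` with
  `U₀⁽⁰⁾ = D_{>a} - ∑_x ϑ_{a,x} D_{>x} - ϑ_* D_{>a}` vanishing, with its `ω`-gradient, off `Z₁`;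
* **the bounds on `U₀`** (`U0_bound`, `dU0_bound`):
  `|U₀| ≤ K (𝟙_{Z₁}(ω) + ∑_{j=1}^n ε^j δ^{-2j}) W^M`,
  `|∂U₀| ≤ K (𝟙_{Z₁}(ω) δ^{-1} + ∑_{j=1}^n ε^j δ^{-(2j+1)}) W^M`, `W = 1 + ‖ω‖`, with `K`, `M`
  independent of `ε`, `δ ∈ (0, 1]`, `q`, `ω`.
-/

noncomputable section

open Function Set Finset Filter Metric
open scoped ContDiff BigOperators Topology

namespace Literature.Barriers.AtomisticToContinuum.HeatConduction.RotorChain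

open Literature.MathematicalPhysics.KineticTheory.HeatConduction
open Literature.Analysis.Calculus Literature.Analysis.Calculus.IsDeltaSymbol
open Literature.Algebra.Lie Literature.Algebra.Lie.TruncSeries

variable {m : ℕ}

/-! ### Generic: every polynomial has a mode bound; classes through `R` -/

/-- Every (finite) symbolic polynomial has a mode bound. [folklore] -/
theorem exists_modeBound (F : TrigPoly m) : ∃ B : ℕ, F.ModeBound B := by
  induction F with
  | nil => exact ⟨0, TrigPoly.modeBound_nil 0⟩
  | cons t F ih =>
    obtain ⟨B, hB⟩ := ih
    refine ⟨B + Finset.univ.sup (fun y => (t.mode y).natAbs), fun s hs y => ?_⟩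
    rcases List.mem_cons.1 hs with rfl | h
    · have h1 : (s.mode y).natAbs ≤ Finset.univ.sup (fun y => (s.mode y).natAbs) :=
        Finset.le_sup (f := fun y => (s.mode y).natAbs) (Finset.mem_univ y)
      have h2 : |s.mode y| = ((s.mode y).natAbs : ℤ) := (Int.natCast_natAbs (s.mode y)).symm
      rw [h2]
      exact_mod_cast le_trans h1 (Nat.le_add_left _ _)
    · exact (hB s h y).trans (by push_cast; omega)

/-- **Classes through `R`**: generators `U^{(k)} ∼ δ^{-(2k-1)}` and input components `∼ δ^{-(2j+a)}`
give all stages of `R` components `∼ δ^{-(2j+a)}`. [cite: DeRoeckHuveneers2015, §3.3 (the relation "`R` depends on `δ`": `R^{(k)} ∼ δ^{-2k}`)] -/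
theorem inClass_rOp_affine {n : ℕ} {Us : ℕ → TrigPoly m} (hU : ∀ k, 1 ≤ k → (Us k).InClass (2 * k - 1)) (rU : ℕ → ℕ) (a : ℕ) :
    ∀ (k : ℕ) {r : ℕ} {S : SymSeries m}, (∀ j ≤ n, (S j).InClass (2 * j + a)) →
      ∀ j ≤ n, (SymSeries.rOp n Us rU k r S j).InClass (2 * j + a) := by
  intro k
  induction k with
  | zero => intro r S hS; exact hS
  | succ k ih =>
    intro r S hS
    refine ih ?_
    refine SymSeries.inClass_expOp (cS := fun j => 2 * j + a) (c := fun j => 2 * j + a) ((hU (k + 1) (Nat.succ_pos k)).neg)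
      hS (fun j _ => le_rfl) ?_
    intro j i _ _ _ hij
    have e : i * (2 * (k + 1) - 1 + 1) = 2 * (i * (k + 1)) := by
      have : 2 * (k + 1) - 1 + 1 = 2 * (k + 1) := by omega
      rw [this]; ring
    rw [e]; omega

section Objects

variable {r L n₂ : ℕ} (Θ : ResonanceCutoffs m r L n₂) (b : Fin m) (n₃ : ℕ) (γ : ℝ) (n : ℕ)

/-! ### Symbolic representatives -/

/-- `H̃_{>a}` as a symbolic series. [cite: DeRoeckHuveneers2015, §5.1 (definition of `H̃_{>a}`)] -/
def hgtSeries : SymSeries m := fun j => hgtPoly Θ b n₃ γ n j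

/-- The symbolic `R H̃_{>a}`. [cite: DeRoeckHuveneers2015, §5.1 (`H_{>a} = 𝒯_{n₁}(R H̃_{>a})`)] -/
def RhgtSym : SymSeries m := SymSeries.rOp n (gen m γ n) (fun _ => stageRad n n) n (bigRad m n) (hgtSeries Θ b n₃ γ n)

/-- The symbolic `H̃ · H̃_{>a}` (truncated bracket), i.e. `L_H̃ H̃_{>a}` order by order. [cite: DeRoeckHuveneers2015, §5.2 (the term `𝒯_{n₁}(R L_H̃ H̃_{>a})`)] -/
def Xsym : SymSeries m := SymSeries.bracketTS (bigRad m n) (bigRad m n) (normalForm m γ n) (hgtSeries Θ b n₃ γ n)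

/-- The symbolic `R(H̃ · H̃_{>a})`. [cite: DeRoeckHuveneers2015, §5.2 (the term `𝒯_{n₁}(R L_H̃ H̃_{>a})`)] -/
def RXsym : SymSeries m :=
  SymSeries.rOp n (gen m γ n) (fun _ => stageRad n n) n (bigRad m n + 2 * bigRad m n) (Xsym Θ b n₃ γ n)

/-- The symbolic `B = {V, (R H̃_{>a})_n}`. [cite: DeRoeckHuveneers2015, §5.2 (the term `ε^{n₁+1} L_V ∑_k R^{(n₁-k)} H̃^{(k)}_{>a}`)] -/
def Bsym : TrigPoly m :=
  TrigPoly.bracket 1 (SymSeries.rRad n (fun _ => stageRad n n) n (bigRad m n)) (potPoly m γ) (RhgtSym Θ b n₃ γ n n)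

variable {Θ b n₃ γ n}

/-- `hgtSeries` is good with the working radius at scales `δ ∈ (0,1]`. [folklore] -/
theorem hgtSeries_good {δ : ℝ} (hδ : 0 < δ) (hδ1 : δ ≤ 1) : (hgtSeries Θ b n₃ γ n).Good n (bigRad m n) δ :=
  fun _ hj => hgtPoly_good hδ hδ1 hj

/-- `RhgtSym` represents `R H̃_{>a}`. [cite: DeRoeckHuveneers2015, §5.1] -/
theorem RhgtSym_represents {δ : ℝ} (hδ : 0 < δ) (hδ1 : δ ≤ 1) :
    SymSeries.Represents δ n (RhgtSym Θ b n₃ γ n) (TruncSeries.rOp (genFun m γ n δ) n (hgtTS Θ b n₃ γ n δ)) :=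
  SymSeries.Represents.rOp (gen_good_top γ n δ) (fun _ hk => val_genFun m γ n δ hk) n (hgtSeries_good hδ hδ1) (hgt_represents hδ hδ1)

/-- `RhgtSym` is good. [folklore] -/
theorem RhgtSym_good {δ : ℝ} (hδ : 0 < δ) (hδ1 : δ ≤ 1) :
    (RhgtSym Θ b n₃ γ n).Good n (SymSeries.rRad n (fun _ => stageRad n n) n (bigRad m n)) δ :=
  SymSeries.Good.rOp (gen_good_top γ n δ) n (hgtSeries_good hδ hδ1)

/-- `H̃_{>a}^{(j)} ∼ δ^{-2(j-1)} ≤ δ^{-2j}` (the partition is of order `0`). [cite: DeRoeckHuveneers2015, §5.6 ("the functions `ϑ_{a,x}, ϑ_{a,*}` are bounded"; `H^O_{>a} - H_{>a} ∼ ∑_n ε^n δ^{-2n}`)] -/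
theorem hgtSeries_inClass : ∀ j ≤ n, (hgtSeries Θ b n₃ γ n j).InClass (2 * j) := by
  intro j hj
  have hN := normalForm_inClass m γ n j hj
  refine (TrigPoly.inClass_flatMap fun x _ => ?_).append ?_
  · exact ((hN.filter (fun t => decide (x < t.pos))).smulFun (isDeltaSymbol_vt (Θ := Θ) (b := b) (n₃ := n₃) x)).mono (by omega)
  · exact ((hN.filter (fun t => decide (b < t.pos))).smulFun (isDeltaSymbol_vtStar (Θ := Θ) (b := b) (n₃ := n₃))).mono (by omega)

/-- **`(R H̃_{>a})_j ∼ δ^{-2j}`.** [cite: DeRoeckHuveneers2015, §5.6 ("`H^O_{>a} - ∑_n ε^n ∑_k R^{(n-k)} H̃^{(k)}_{>a} ∼ ∑_n ε^n δ^{-2n}` with the dominant contribution for each `n` coming from the `k = 0` term")] -/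
theorem RhgtSym_inClass : ∀ j ≤ n, (RhgtSym Θ b n₃ γ n j).InClass (2 * j) := by
  intro j hj
  unfold RhgtSym
  have := inClass_rOp_affine (n := n) (fun k _ => gen_inClass m γ n k) (fun _ => stageRad n n) 0 n
    (S := hgtSeries Θ b n₃ γ n) (r := bigRad m n) (fun j' hj' => (hgtSeries_inClass j' hj').mono (by omega)) j hj
  simpa using this

/-- `Xsym` represents `H̃ · H̃_{>a}`. [cite: DeRoeckHuveneers2015, §5.2] -/
theorem Xsym_represents {δ : ℝ} (hδ : 0 < δ) (hδ1 : δ ≤ 1) :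
    SymSeries.Represents δ n (Xsym Θ b n₃ γ n)
      (TruncSeries.qOp (genFun m γ n δ) n (hamTS m γ n) * hgtTS Θ b n₃ γ n δ) :=
  SymSeries.Represents.bracketTS (fun _ hj => normalForm_good_bigRad γ n δ hj) (hgtSeries_good hδ hδ1)
    (normalForm_represents m γ n δ) (hgt_represents hδ hδ1)

/-- `Xsym` is good with radius `3 · bigRad`. [folklore] -/
theorem Xsym_good {δ : ℝ} (hδ : 0 < δ) (hδ1 : δ ≤ 1) : (Xsym Θ b n₃ γ n).Good n (bigRad m n + 2 * bigRad m n) δ :=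
  SymSeries.Good.bracketTS (fun _ hj => normalForm_good_bigRad γ n δ hj) (hgtSeries_good hδ hδ1)

/-- `X_l ∼ δ^{-(2l+1)}`. [cite: DeRoeckHuveneers2015, §5.6 ("`∂_♯ 𝒯_{n₁}(R L_H̃ H̃_{>a}) = ∑_{k=0}^{n₁} ε^k (…)^{(k)} ∼ ∑_k ε^k δ^{-(2+2k)}`")] -/
theorem Xsym_inClass : ∀ l ≤ n, (Xsym Θ b n₃ γ n l).InClass (2 * l + 1) :=
  SymSeries.inClass_bracketTS (cS := fun i => 2 * (i - 1)) (cS' := fun j => 2 * j) (normalForm_inClass m γ n)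
    hgtSeries_inClass (fun j i _ _ => by omega)

/-- `RXsym` represents `R(H̃ · H̃_{>a})`. [cite: DeRoeckHuveneers2015, §5.2] -/
theorem RXsym_represents {δ : ℝ} (hδ : 0 < δ) (hδ1 : δ ≤ 1) :
    SymSeries.Represents δ n (RXsym Θ b n₃ γ n)
      (TruncSeries.rOp (genFun m γ n δ) n (TruncSeries.qOp (genFun m γ n δ) n (hamTS m γ n) * hgtTS Θ b n₃ γ n δ)) :=
  SymSeries.Represents.rOp (gen_good_top γ n δ) (fun _ hk => val_genFun m γ n δ hk) n (Xsym_good hδ hδ1) (Xsym_represents hδ hδ1)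

/-- `(RX)_l ∼ δ^{-(2l+1)}`. [cite: DeRoeckHuveneers2015, §5.6 ("`∂_♯ 𝒯_{n₁}(R L_H̃ H̃_{>a}) ∼ ∑_k ε^k δ^{-(2+2k)}`")] -/
theorem RXsym_inClass : ∀ l ≤ n, (RXsym Θ b n₃ γ n l).InClass (2 * l + 1) := by
  intro l hl
  unfold RXsym
  exact inClass_rOp_affine (n := n) (fun k _ => gen_inClass m γ n k) (fun _ => stageRad n n) 1 n Xsym_inClass l hl

/-- **`A = ∑_l ε^l ev (RX)_l`.** [cite: DeRoeckHuveneers2015, §5.2 (the term `𝒯_{n₁}(R L_H̃ H̃_{>a})`)] -/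
theorem Aterm_eq_sum {δ : ℝ} (hδ : 0 < δ) (hδ1 : δ ≤ 1) (ε : ℝ) (z : PhaseSpace m) :
    Aterm Θ b n₃ γ n ε δ z = ∑ l ∈ Finset.range (n + 1), ε ^ l * TrigPoly.ev (RXsym Θ b n₃ γ n l) δ z := by
  unfold Aterm
  rw [SmoothFun.val_eval]
  exact Finset.sum_congr rfl fun l hl => by rw [RXsym_represents hδ hδ1 l (Nat.lt_succ_iff.1 (Finset.mem_range.1 hl))]

/-- **`𝒯R H̃_{>a} = ∑_j ε^j ev (RH̃_{>a})_j`.** [cite: DeRoeckHuveneers2015, §5.1 (`H_{>a} = 𝒯_{n₁}(R H̃_{>a})`)] -/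
theorem eval_Rhgt_eq_sum {δ : ℝ} (hδ : 0 < δ) (hδ1 : δ ≤ 1) (ε : ℝ) (z : PhaseSpace m) :
    (TruncSeries.eval ε (TruncSeries.rOp (genFun m γ n δ) n (hgtTS Θ b n₃ γ n δ))).val z =
      ∑ j ∈ Finset.range (n + 1), ε ^ j * TrigPoly.ev (RhgtSym Θ b n₃ γ n j) δ z := by
  rw [SmoothFun.val_eval]
  exact Finset.sum_congr rfl fun j hj => by rw [RhgtSym_represents hδ hδ1 j (Nat.lt_succ_iff.1 (Finset.mem_range.1 hj))]

/-- **`B = ev Bsym`.** [cite: DeRoeckHuveneers2015, §5.2] -/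
theorem Bterm_eq_ev {δ : ℝ} (hδ : 0 < δ) (hδ1 : δ ≤ 1) (z : PhaseSpace m) :
    Bterm Θ b n₃ γ n δ z = TrigPoly.ev (Bsym Θ b n₃ γ n) δ z := by
  unfold Bterm Bsym
  have hV : (potPoly m γ).Good 1 δ := by
    have := hamSeries_good m 1 γ δ 1 le_rfl
    simpa [hamSeries] using this
  have e : potentialEnergy m γ = TrigPoly.ev (potPoly m γ) δ := funext fun z => (ev_potPoly γ δ z).symm
  rw [e, RhgtSym_represents hδ hδ1 n le_rfl]
  exact (hV.poisson_ev_ev ((RhgtSym_good hδ hδ1) n le_rfl) z)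

/-- `B ∼ δ^{-(2n+1)}`. [cite: DeRoeckHuveneers2015, §5.6 ("`∂_♯ L_V ∑_{k=0}^{n₁} R^{(n₁-k)} H̃^{(k)}_{>a} ∼ δ^{-2n₁-2}`")] -/
theorem Bsym_inClass : (Bsym Θ b n₃ γ n).InClass (2 * n + 1) := by
  have hV : (potPoly m γ).InClass 0 := potPoly_inClass m γ
  have := hV.bracket (RhgtSym_inClass (Θ := Θ) (b := b) (n₃ := n₃) (γ := γ) (n := n) n le_rfl) 1
    (SymSeries.rRad n (fun _ => stageRad n n) n (bigRad m n))
  unfold Bsym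
  simpa using this

/-! ### The order-`0` part of `U₀` -/

/-- The right tails of `D`: `D_{>x} = ∑_{y > x} ½ω_y²` (a function of `ω`). [cite: DeRoeckHuveneers2015, §5.6 ("`(H^O_{>a} - H_{>a})^{(0)} = ∑_{x>a} D_x - ∑_{x∈B(a,n₃)} ϑ_{a,x} ∑_{y>x} D_y - ϑ_{a,*} ∑_{y>a} D_y`")] -/
def tailD (x : Fin m) : TrigPoly m := tailP x (kinPoly m)

/-- The right tails of `V`. [cite: DeRoeckHuveneers2015, §5.1 (`H^O_{>a} = ∑_{x>a} H_x`)] -/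
def tailV (x : Fin m) (γ : ℝ) : TrigPoly m := tailP x (potPoly m γ)

/-- `H^O_{>a} = ev D_{>a} + ε ev V_{>a}`. [cite: DeRoeckHuveneers2015, §5.1 (`H^O_{>a} = ∑_{x>a} H_x`)] -/
theorem tailEnergy_eq_ev (ε γ δ : ℝ) (z : PhaseSpace m) :
    tailEnergy m ε γ (b.val + 1) z = TrigPoly.ev (tailD b) δ z + ε * TrigPoly.ev (tailV b γ) δ z := by
  unfold tailEnergy tailD tailV tailP kinPoly potPoly
  -- kinetic tail
  have hK : TrigPoly.ev ((List.ofFn (kinTerm (m := m))).filter fun t => decide (b < t.pos)) δ z =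
      ∑ x : Fin m, if b.val + 1 ≤ x.val then z.2 x ^ 2 / 2 else 0 := by
    rw [TrigPoly.ev, List.ofFn_eq_map, List.filter_map, List.map_map]
    have : ∀ l : List (Fin m), ((l.filter ((fun t => decide (b < t.pos)) ∘ kinTerm)).map ((fun t => t.ev δ z) ∘ kinTerm)).sum =
        (l.map fun x => if b.val + 1 ≤ x.val then z.2 x ^ 2 / 2 else 0).sum := by
      intro l
      induction l with
      | nil => simp
      | cons x l ih =>
        rw [List.filter_cons]
        by_cases hx : b < x
        · have hx' : b.val + 1 ≤ x.val := hx
          simp only [Function.comp, kinTerm, hx, decide_true, if_true, List.map_cons, List.sum_cons, hx'] at ih ⊢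
          rw [ih]; simp [TrigTerm.ev, modePhase]
        · have hx' : ¬ b.val + 1 ≤ x.val := fun h => hx h
          simp only [Function.comp, kinTerm, hx, decide_false, List.map_cons, List.sum_cons, hx', if_false, zero_add] at ih ⊢
          simp only [Bool.false_eq_true, if_false]
          exact ih
    rw [this, ← List.ofFn_eq_map, List.sum_ofFn]
  -- potential tail
  have hV : TrigPoly.ev (((List.finRange m).flatMap (potTerms γ)).filter fun t => decide (b < t.pos)) δ z =
      ∑ x : Fin m, if b.val + 1 ≤ x.val then sitePotential m γ z.1 x else 0 := by
    rw [List.filter_flatMap, TrigPoly.ev_flatMap]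
    have hf : ∀ x : Fin m, TrigPoly.ev ((potTerms γ x).filter fun t => decide (b < t.pos)) δ z =
        if b.val + 1 ≤ x.val then sitePotential m γ z.1 x else 0 := by
      intro x
      have hpos : ∀ t ∈ potTerms (m := m) γ x, t.pos = x := by
        intro t ht
        unfold potTerms at ht
        rcases List.mem_append.1 ht with h | h
        · simp only [List.mem_cons, List.mem_nil_iff, or_false] at h; rcases h with rfl | rfl <;> rfl
        · by_cases hb : x.val + 1 < m
          · rw [dif_pos hb] at h; simp only [List.mem_cons, List.mem_nil_iff, or_false] at h; rcases h with rfl | rfl <;> rfl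
          · rw [dif_neg hb] at h; simp at h
      by_cases hx : b < x
      · have hx' : b.val + 1 ≤ x.val := hx
        rw [if_pos hx', List.filter_eq_self.2 (fun t ht => by rw [hpos t ht]; simpa using hx), ev_potTerms]
      · have hx' : ¬ b.val + 1 ≤ x.val := fun h => hx h
        rw [if_neg hx', List.filter_eq_nil_iff.2 (fun t ht => by rw [hpos t ht]; simpa using hx), TrigPoly.ev_nil]
    simp only [hf]
    rw [← List.ofFn_eq_map, List.sum_ofFn]
  rw [hK, hV, Finset.mul_sum, ← Finset.sum_add_distrib]
  refine Finset.sum_congr rfl fun x _ => ?_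
  unfold siteEnergy
  split_ifs <;> ring

/-- `U₀⁽⁰⁾ = D_{>a} - ∑_x ϑ_{a,x} D_{>x} - ϑ_* D_{>a}` (a function of `ω`; written at phase points).
[cite: DeRoeckHuveneers2015, §5.6 ("`(H^O_{>a} - H_{>a})^{(0)} = ∑_{x>a} D_x - ∑_{x∈B(a,n₃)} ϑ_{a,x} ∑_{y>x} D_y - ϑ_{a,*} ∑_{y>a} D_y`")] -/
def U0zero (Θ : ResonanceCutoffs m r L n₂) (b : Fin m) (n₃ : ℕ) (δ : ℝ) (z : PhaseSpace m) : ℝ :=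
  TrigPoly.ev (tailD b) δ z - (∑ x ∈ nearSites b n₃, vt Θ b n₃ x δ z.2 * TrigPoly.ev (tailD x) δ z +
    vtStar Θ b n₃ δ z.2 * TrigPoly.ev (tailD b) δ z)

/-- `(R F)_0 = F_0`. [folklore] -/
theorem rOp_coeff_zero {n : ℕ} (u : ℕ → SmoothFun m) : ∀ (k : ℕ) (F : TruncSeries (SmoothFun m) n),
    (TruncSeries.rOp u k F).coeff 0 = F.coeff 0 := by
  intro k
  induction k with
  | zero => intro F; rfl
  | succ k ih => intro F; rw [TruncSeries.rOp_succ, ih, TruncSeries.expOp_coeff_of_lt (Nat.succ_pos k) _ _ (Nat.succ_pos k) (Nat.zero_le n)]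

/-- `ev (RH̃_{>a})_0 = ev H̃_{>a}^{(0)} = ∑_x ϑ_{a,x} D_{>x} + ϑ_* D_{>a}`. [cite: DeRoeckHuveneers2015, §5.6 (`H̃^{(0)}_{>a}` in the display for `(H^O_{>a} - H_{>a})^{(0)}`)] -/
theorem ev_RhgtSym_zero {δ : ℝ} (hδ : 0 < δ) (hδ1 : δ ≤ 1) (z : PhaseSpace m) :
    TrigPoly.ev (RhgtSym Θ b n₃ γ n 0) δ z =
      ∑ x ∈ nearSites b n₃, vt Θ b n₃ x δ z.2 * TrigPoly.ev (tailD x) δ z + vtStar Θ b n₃ δ z.2 * TrigPoly.ev (tailD b) δ z := by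
  rw [← RhgtSym_represents hδ hδ1 0 (Nat.zero_le n), rOp_coeff_zero, val_hgtTS_coeff hδ hδ1 (Nat.zero_le n), ev_hgtPoly_eq]
  simp only [tailD, normalForm, stage_apply_zero]

/-- **The decomposition of `U₀`**: `U₀ = U₀⁽⁰⁾ + ε ev V_{>a} - ∑_{j=1}^n ε^j ev (RH̃_{>a})_j`.
[cite: DeRoeckHuveneers2015, §5.6 ("`H^O_{>a} - H_{>a} = ∑_{n=0}^{n₁} ε^n (H^O_{>a} - H_{>a})^{(n)}`")] -/
theorem U0_decomp {δ : ℝ} (hδ : 0 < δ) (hδ1 : δ ≤ 1) (ε : ℝ) (z : PhaseSpace m) :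
    U0 Θ b n₃ γ n ε δ z = U0zero Θ b n₃ δ z + ε * TrigPoly.ev (tailV b γ) δ z -
      ∑ j ∈ Finset.Ico 1 (n + 1), ε ^ j * TrigPoly.ev (RhgtSym Θ b n₃ γ n j) δ z := by
  unfold U0 U0zero
  rw [eval_Rhgt_eq_sum hδ hδ1, tailEnergy_eq_ev ε γ δ z, Finset.range_eq_Ico, Finset.sum_eq_sum_Ico_succ_bot (Nat.succ_pos n),
    pow_zero, one_mul, ev_RhgtSym_zero hδ hδ1]
  ring

/-- **Off `Z₁`, `U₀⁽⁰⁾ = 0`** (all `θ_x = 1`: `ϑ_{a,x} = [x = a]`, `ϑ_* = 0`). [cite: DeRoeckHuveneers2015, §5.6 ("`ϑ_{a,x}(ω) = δ_{a,x}`, `ϑ_{a,*}(ω) = 0`, `(H^O_{>a} - H_{>a})^{(0)}(ω,q) = 0`, for `(ω,q) ∈ Ω ∖ W`")] -/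
theorem U0zero_eq_zero {δ : ℝ} (hδ : 0 < δ) (hδ1 : δ ≤ 1) {R₁ : ℕ} (hR : n₃ + Θ.RS ≤ R₁) {z : PhaseSpace m}
    (hz : z.2 ∉ Z1set m r b R₁ ((L : ℝ) ^ (n₂ + 1) * δ)) : U0zero Θ b n₃ δ z = 0 := by
  have hgood : ∀ y ∈ nearSites b n₃, Θ.θ y δ z.2 = 1 := fun y hy => theta_eq_one_of_not_mem_Z1set hδ hδ1 hR hz hy
  unfold U0zero
  simp only [vt_of_good hgood, vtStar_of_good hgood, zero_mul, add_zero, ite_mul, one_mul,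
    Finset.sum_ite_eq' (nearSites b n₃) b, if_pos (self_mem_nearSites b n₃), sub_self]

/-- `∂_{q_y} U₀⁽⁰⁾ = 0` (a function of `ω`). [folklore] -/
theorem partialQ_U0zero (δ : ℝ) (y : Fin m) (z : PhaseSpace m) : partialQ y (U0zero Θ b n₃ δ) z = 0 := by
  -- every `tailD` term has mode `0`, and the partition functions depend on `ω` only
  have hD : ∀ (x : Fin m) (z' : PhaseSpace m), TrigPoly.ev (tailD x) δ z' = TrigPoly.ev (tailD x) δ (z.1, z'.2) := by
    intro x z'
    unfold tailD tailP TrigPoly.ev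
    congr 1
    refine List.map_congr_left fun t ht => ?_
    have ht' := (List.mem_filter.1 ht).1
    rw [kinPoly, List.mem_ofFn] at ht'
    obtain ⟨y', rfl⟩ := ht'
    simp [kinTerm, TrigTerm.ev, modePhase]
  unfold partialQ
  have e : (fun t => U0zero Θ b n₃ δ (Function.update z.1 y t, z.2)) = fun _ => U0zero Θ b n₃ δ z := by
    funext t
    unfold U0zero
    simp only [hD _ (Function.update z.1 y t, z.2), hD _ z]
  rw [e, deriv_const]

/-- **Off `Z₁`, `∂_ω U₀⁽⁰⁾ = 0`** (gradients of the partition vanish on the good set). [cite: DeRoeckHuveneers2015, §5.6 ("`(H^O_{>a} - H_{>a})^{(0)} = χ_W · (H^O_{>a} - H_{>a})^{(0)}`", differentiated off the closed set `Z₁ ⊇ W`)] -/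
theorem partialP_U0zero_eq_zero {δ : ℝ} (hδ : 0 < δ) (hδ1 : δ ≤ 1) {R₁ : ℕ} (hR : n₃ + Θ.RS ≤ R₁) {z : PhaseSpace m}
    (hz : z.2 ∉ Z1set m r b R₁ ((L : ℝ) ^ (n₂ + 1) * δ)) (y : Fin m) : partialP y (U0zero Θ b n₃ δ) z = 0 := by
  have hgood : ∀ y ∈ nearSites b n₃, Θ.θ y δ z.2 = 1 := fun y hy => theta_eq_one_of_not_mem_Z1set hδ hδ1 hR hz hy
  have hDd : ∀ x : Fin m, Differentiable ℝ (TrigPoly.ev (tailD (m := m) x) δ) := fun x =>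
    TrigPoly.differentiable_ev _ fun t ht => by
      have := ((hamSeries_good m 0 0 δ 0 le_rfl).filter (fun t => decide (x < t.pos))).2 t (by simpa [hamSeries, tailD, tailP] using ht)
      exact this.differentiable
  have hvt : ∀ x, Differentiable ℝ (fun z : PhaseSpace m => vt Θ b n₃ x δ z.2) := fun x =>
    ((contDiff_vt hδ hδ1 x).differentiable (by simp)).comp differentiable_snd
  have hvs : Differentiable ℝ (fun z : PhaseSpace m => vtStar Θ b n₃ δ z.2) :=
    ((contDiff_vtStar hδ hδ1).differentiable (by simp)).comp differentiable_snd
  -- write `U0zero` as a combination and differentiate termwise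
  have e : U0zero Θ b n₃ δ = TrigPoly.ev (tailD b) δ - ((fun z => ∑ x ∈ nearSites b n₃,
      ((fun z : PhaseSpace m => vt Θ b n₃ x δ z.2) * TrigPoly.ev (tailD x) δ) z) +
        (fun z : PhaseSpace m => vtStar Θ b n₃ δ z.2) * TrigPoly.ev (tailD b) δ) := by
    funext z; simp [U0zero]
  have hsum : Differentiable ℝ (fun z => ∑ x ∈ nearSites b n₃, ((fun z : PhaseSpace m => vt Θ b n₃ x δ z.2) * TrigPoly.ev (tailD x) δ) z) :=
    Differentiable.fun_sum fun x _ => (hvt x).mul (hDd x)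
  rw [e]
  rw [show (TrigPoly.ev (tailD b) δ - ((fun z => ∑ x ∈ nearSites b n₃, ((fun z : PhaseSpace m => vt Θ b n₃ x δ z.2) * TrigPoly.ev (tailD x) δ) z) +
      (fun z : PhaseSpace m => vtStar Θ b n₃ δ z.2) * TrigPoly.ev (tailD b) δ)) =
      (TrigPoly.ev (tailD b) δ + fun z => (-1 : ℝ) * (((fun z => ∑ x ∈ nearSites b n₃, ((fun z : PhaseSpace m => vt Θ b n₃ x δ z.2) * TrigPoly.ev (tailD x) δ) z) +
      (fun z : PhaseSpace m => vtStar Θ b n₃ δ z.2) * TrigPoly.ev (tailD b) δ)) z) from by funext z; simp; ring]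
  rw [partialP_add (hDd b) ((hsum.add (hvs.mul (hDd b))).const_mul (-1)), partialP_const_mul,
    partialP_add hsum (hvs.mul (hDd b)), partialP_mul hvs (hDd b), partialP_comp_snd ((contDiff_vtStar hδ hδ1).differentiable (by simp)),
    fderiv_vtStar_of_good hgood, vtStar_of_good hgood]
  -- the sum over `x`
  have hS : partialP y (fun z => ∑ x ∈ nearSites b n₃, ((fun z : PhaseSpace m => vt Θ b n₃ x δ z.2) * TrigPoly.ev (tailD x) δ) z) z =
      partialP y (TrigPoly.ev (tailD b) δ) z := by
    have hps : ∀ s : Finset (Fin m), partialP y (fun z => ∑ x ∈ s, ((fun z : PhaseSpace m => vt Θ b n₃ x δ z.2) * TrigPoly.ev (tailD x) δ) z) z =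
        ∑ x ∈ s, partialP y ((fun z : PhaseSpace m => vt Θ b n₃ x δ z.2) * TrigPoly.ev (tailD x) δ) z := by
      intro s
      induction s using Finset.induction_on with
      | empty => simp [partialP_const]
      | insert a s ha ih =>
        simp only [Finset.sum_insert ha]
        rw [show (fun z => ((fun z : PhaseSpace m => vt Θ b n₃ a δ z.2) * TrigPoly.ev (tailD a) δ) z +
            ∑ x ∈ s, ((fun z : PhaseSpace m => vt Θ b n₃ x δ z.2) * TrigPoly.ev (tailD x) δ) z) =
            ((fun z : PhaseSpace m => vt Θ b n₃ a δ z.2) * TrigPoly.ev (tailD a) δ) + fun z =>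
              ∑ x ∈ s, ((fun z : PhaseSpace m => vt Θ b n₃ x δ z.2) * TrigPoly.ev (tailD x) δ) z from rfl,
          partialP_add ((hvt a).mul (hDd a)) (Differentiable.fun_sum fun x _ => (hvt x).mul (hDd x)), ih]
    rw [hps]
    have hterm : ∀ x ∈ nearSites b n₃, partialP y ((fun z : PhaseSpace m => vt Θ b n₃ x δ z.2) * TrigPoly.ev (tailD x) δ) z =
        (if x = b then 1 else 0) * partialP y (TrigPoly.ev (tailD x) δ) z := by
      intro x hx
      rw [partialP_mul (hvt x) (hDd x), partialP_comp_snd ((contDiff_vt hδ hδ1 x).differentiable (by simp)),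
        fderiv_vt_of_good hgood hx, vt_of_good hgood]
      simp
    rw [Finset.sum_congr rfl hterm]
    simp only [ite_mul, one_mul, zero_mul, Finset.sum_ite_eq' (nearSites b n₃) b, if_pos (self_mem_nearSites b n₃)]
  rw [hS]
  simp

end Objects

end Literature.Barriers.AtomisticToContinuum.HeatConduction.RotorChain

end
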